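import Literature.AlgebraicGeometry.Resolution.WeightedCentreBendingCube
import HarnessLib

/-!
# The whole bending ladder: `max W(x^{p^e} + y^p + y^{p+1}) = (p, 1 + p + ⋯ + p^e)` for every `e ≥ 1`

[ATW24] Abramovich–Temkin–Włodarczyk, *Functorial embedded resolution via weighted blowings up*,
Algebra & Number Theory 18 (2024), §5.1 (p. 1575), Thm. 5.3.1 (2)–(3) (p. 1578), Lemma 5.2.6 (p. 1576),
Rem. 5.2.3 / Def. 2.4.1 (2) (pp. 1568, 1576: the monomial valuation and domination).
[CJS20] Cossart–Jannsen–Saito, *Desingularization: Invariants and Strategy*, LNM 2270 (2020), Def. 8.1 (3) /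
Def. 8.2 (1) (pp. 117–118: `δ(f; u; y)`), Def. 8.8 / Thm. 8.16 (pp. 119–121: vertex preparation `y ↦ y + λ u^A`,
dissolving the solvable vertices one at a time).
[Hau10] Hauser, Bull. AMS 47 (2010), §C (p. 9: failure of maximal contact) and §D (p. 12: kangaroo points).
[HP19b] Hauser–Perlega, Publ. RIMS 60 (2024), §7 (p. 798: the residual order of `z^{p^e} + F`).

## What is proved (the polynomial `W(f)` model of `WeightedCentreInvariantSet`; `char k = p`; `x = X 0`, `y = X 1`)

An abstract form of the bent polynomials of `WeightedCentreBendingWitness` / `WeightedCentreBendingCube` that is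
stable under the passage `e ↦ e + 1`, so that the ladder closes by induction instead of by listing monomials:

* `IsBent p K a G` — `G = y^p + x^K − x^a y + R` where every monomial `x^i y^j` of `R` has `p i + K j ≥ p K + 2`
  (weights `1/K` on `x`, `1/p` on `y`; the three named monomials have weights `pK, pK, pK + 1` when `p a + K = p K + 1`);
  stated as one inequality for the monomial valuation `ν_{(p,K)}(G − (y^p + x^K − x^a y)) ≥ pK + 2`.
* **`IsBent.isMaxInv` — a bent polynomial has `max W(G) = (p, K)`** (`2 ≤ p < K`, `p a + K = p K + 1`, `p ∤ K`; any
  field): `(p, K) ∈ W(G)` by the weights above (`IsBent.mem_admissibleInvariants`), and no invariant exceeds it by the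
  two-variable vertex bound of `WeightedCentreBendingCube` (`ord G = p`, `in_p G = y^p`, `δ(G; x; y) = K/p` —
  `IsBent.monomialOrd_one`, `IsBent.homogeneousComponent_eq`, `IsBent.hironakaDelta_eq` — and vacuous preparedness).
* **`IsBent.step` — the substitution `T_K : x ↦ x^p, y ↦ y − x^K` maps bent to bent**: in characteristic `p`,
  `IsBent p K a G ⟹ IsBent p (pK + 1) (p a) (T_K G)` (Frobenius `(y − x^K)^p = y^p − x^{pK}` dissolves the vertex
  `x^{pK}` of `G(x^p, y)`; the monomial `−x^a y` becomes the new vertex `x^{pa + K} = x^{pK+1}` and the new `−x^{pa} y`;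
  `ν_{(p, pK+1)}(T_K R) ≥ p · ν_{(p,K)}(R)` by domination of the monomial valuation, [ATW24, Rem. 5.2.3]).
* The ladder: `bendK p e = 1 + p + ⋯ + p^e` (`bendK_eq_sum`), the shift `γ_e` (`bendShift`: `γ₁ = x`,
  `γ_{e+1} = T_{K_e} γ_e + x^{K_e}`, a polynomial in `x` vanishing at `0`), the bent form
  `bendForm k p e = F_e(x, y − γ_e)` of `F_e = x^{p^e} + y^p + y^{p+1}`, the recursion **`bendForm_succ`:
  `G_{e+1} = T_{K_e} G_e`** (because `F_{e+1}(x, z) = F_e(x^p, z)`), `isBent_bendForm` (induction from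
  `G₁ = y^p + (y − x)^{p+1} = y^p + x^{p+1} − x^p y + (y^{p+1} − x y^p)`), and finally
* **`isMaxInv_bending_pow` — `max W(x^{p^e} + y^p + y^{p+1}) = (p, 1 + p + ⋯ + p^e)` for every prime `p` and every
  `e ≥ 1`** (`(p − 1) K_e + 1 = p^{e+1}`: `bend_rel`), with the instances `(p, p+1)`, `(p, p²+p+1)`, `(p, p³+p²+p+1)` of
  the earlier files and the new **`isMaxInv_bending_two_pow_four` — `max W(x¹⁶ + y² + y³) = (2, 31)`** and
  **`isMaxInv_bending_two_pow_five` — `max W(x³² + y² + y³) = (2, 63)`**.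

This types the observatory's staircase theorem (engine 1, Thm. H, case `r = 1`) for every `e` at once: in split
coordinates the best centre for `x^{p^e} + y^p + y^{p+1}` has invariant `(p, p^e)`, while the maximum
`(p, K_e) = (p, p^e + p^{e−1} + ⋯ + 1) = (p, (p^{e+1} − 1)/(p − 1))` is attained only after the `e`-term coordinate change
`y ↦ y − γ_e(x)`.  Value type: typed theorems in the polynomial `W(f)` model — not a resolution theorem.
-/

noncomputable section

open MvPolynomial

namespace Literature.AlgebraicGeometry.Resolution

namespace WeightedBlowup

variable {k : Type*} [Field k]

/-! ## §1 Plumbing (two variables) -/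

/-- The inverse shear on the sheared variable (plumbing). [folklore] -/
private theorem addPolyShear_symm_X_self₂₁ {σ : Type*} [DecidableEq σ] (a : σ) (q : MvPolynomial σ k) :
    (addPolyShear a q).symm (X a) = X a - killVar a q := by
  simp [addPolyShear, sub_eq_add_neg]

/-- The inverse shear fixes the other variables (plumbing). [folklore] -/
private theorem addPolyShear_symm_X_of_ne₂₁ {σ : Type*} [DecidableEq σ] (a : σ) (q : MvPolynomial σ k) {x : σ}
    (hx : x ≠ a) : (addPolyShear a q).symm (X x) = X x := by
  simp [addPolyShear, hx]

/-- `ν_w(x^i y^j) = i·w₀ + j·w₁` (plumbing). [cite: AbramovichTemkinWlodarczyk2024, Rem. 2.4.2 (p. 1568)] -/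
private theorem monomialOrd_X_pow_mul_X_pow₂₁ (w : Fin 2 → ℕ) (i j : ℕ) :
    monomialOrd w (X 0 ^ i * X 1 ^ j : MvPolynomial (Fin 2) k) = ((i * w 0 + j * w 1 : ℕ) : ℕ∞) := by
  rw [monomialOrd_mul, X_pow_eq_monomial, X_pow_eq_monomial, monomialOrd_monomial w _ one_ne_zero,
    monomialOrd_monomial w _ one_ne_zero, Finsupp.weight_single, Finsupp.weight_single, smul_eq_mul, smul_eq_mul,
    Nat.cast_add]

/-- `ν_w(x_a^i) = i·w_a` (plumbing). [cite: AbramovichTemkinWlodarczyk2024, Rem. 2.4.2 (p. 1568)] -/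
private theorem monomialOrd_X_pow₂₁ (w : Fin 2 → ℕ) (a : Fin 2) (i : ℕ) :
    monomialOrd w (X a ^ i : MvPolynomial (Fin 2) k) = ((i * w a : ℕ) : ℕ∞) := by
  rw [X_pow_eq_monomial, monomialOrd_monomial w _ one_ne_zero, Finsupp.weight_single, smul_eq_mul]

/-- `ν_w(−F) = ν_w(F)` (plumbing). [cite: AbramovichTemkinWlodarczyk2024, Rem. 5.2.3] -/
private theorem monomialOrd_neg₂₁ {σ : Type*} (w : σ → ℕ) (F : MvPolynomial σ k) :
    monomialOrd w (-F) = monomialOrd w F := by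
  rw [show -F = C (-1 : k) * F by rw [C_neg, C_1, neg_one_mul]]
  exact monomialOrd_mul_of_constantCoeff_ne_zero w (by rw [constantCoeff_C]; exact neg_ne_zero.2 one_ne_zero) F

/-- `n ≤ ν(A)`, `n ≤ ν(B)` ⟹ `n ≤ ν(A + B)` (plumbing). [cite: AbramovichTemkinWlodarczyk2024, Lemma 5.2.6] -/
private theorem le_monomialOrd_add₂₁ {σ : Type*} (w : σ → ℕ) {A B : MvPolynomial σ k} {n : ℕ∞}
    (hA : n ≤ monomialOrd w A) (hB : n ≤ monomialOrd w B) : n ≤ monomialOrd w (A + B) :=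
  le_trans (le_min hA hB) (min_monomialOrd_le_add w A B)

/-- `n ≤ ν(A)`, `n ≤ ν(B)` ⟹ `n ≤ ν(A − B)` (plumbing). [cite: AbramovichTemkinWlodarczyk2024, Lemma 5.2.6] -/
private theorem le_monomialOrd_sub₂₁ {σ : Type*} (w : σ → ℕ) {A B : MvPolynomial σ k} {n : ℕ∞}
    (hA : n ≤ monomialOrd w A) (hB : n ≤ monomialOrd w B) : n ≤ monomialOrd w (A - B) := by
  rw [sub_eq_add_neg]
  exact le_monomialOrd_add₂₁ w hA (by rwa [monomialOrd_neg₂₁])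

/-- Coefficients of `x^i y^j` (plumbing). [folklore] -/
private theorem coeff_X_pow_mul_X_pow₂₁ (i j : ℕ) (d : Fin 2 →₀ ℕ) :
    coeff d (X 0 ^ i * X 1 ^ j : MvPolynomial (Fin 2) k) =
      if Finsupp.single (0 : Fin 2) i + Finsupp.single 1 j = d then 1 else 0 := by
  classical
  rw [X_pow_eq_monomial, X_pow_eq_monomial, monomial_mul, mul_one, coeff_monomial]

/-- The exponent `(i, j)` evaluated (plumbing). [folklore] -/
private theorem e_apply_zero₂₁ (i j : ℕ) : (Finsupp.single (0 : Fin 2) i + Finsupp.single 1 j : Fin 2 →₀ ℕ) 0 = i := by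
  simp

/-- The exponent `(i, j)` evaluated (plumbing). [folklore] -/
private theorem e_apply_one₂₁ (i j : ℕ) : (Finsupp.single (0 : Fin 2) i + Finsupp.single 1 j : Fin 2 →₀ ℕ) 1 = j := by
  simp

/-- The total degree of the exponent `(i, j)` (plumbing). [folklore] -/
private theorem degree_e₂₁ (i j : ℕ) : (Finsupp.single (0 : Fin 2) i + Finsupp.single 1 j : Fin 2 →₀ ℕ).degree = i + j := by
  rw [map_add, Finsupp.degree_single, Finsupp.degree_single]

/-- Exponents `(i, j)` are determined by `i` and `j` (plumbing). [folklore] -/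
private theorem e_eq_e_iff₂₁ {i j i' j' : ℕ} :
    (Finsupp.single (0 : Fin 2) i + Finsupp.single 1 j : Fin 2 →₀ ℕ) = Finsupp.single 0 i' + Finsupp.single 1 j' ↔
      i = i' ∧ j = j' := by
  constructor
  · intro h
    have h0 := DFunLike.congr_fun h 0
    have h1 := DFunLike.congr_fun h 1
    rw [e_apply_zero₂₁, e_apply_zero₂₁] at h0
    rw [e_apply_one₂₁, e_apply_one₂₁] at h1
    exact ⟨h0, h1⟩
  · rintro ⟨rfl, rfl⟩
    rfl

/-- Every exponent of `k[x, y]` is an `(i, j)` (plumbing). [folklore] -/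
private theorem eq_e₂₁ (d : Fin 2 →₀ ℕ) : d = Finsupp.single (0 : Fin 2) (d 0) + Finsupp.single 1 (d 1) := by
  ext i
  fin_cases i <;> simp

/-- The total degree of an exponent of `k[x, y]` (plumbing). [folklore] -/
private theorem degree_fin_two₂₁ (d : Fin 2 →₀ ℕ) : d.degree = d 0 + d 1 := by
  conv_lhs => rw [eq_e₂₁ d]
  rw [degree_e₂₁]

/-- The invariant of the two-weight centre `(1/a on y, 1/b on x)`, `a ≤ b` (plumbing). [folklore] -/
private theorem exps_singleWeights_add₂₁ {a b : ℕ} (ha : 0 < a) (hb : 0 < b) (hab : (a : ℚ) ≤ b) :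
    exps (singleWeights (1 : Fin 2) a + singleWeights (0 : Fin 2) b) = [(a : ℚ), (b : ℚ)] := by
  classical
  have hdisj : ∀ x : Fin 2, singleWeights (1 : Fin 2) a x = 0 ∨ singleWeights (0 : Fin 2) b x = 0 := by
    intro x
    by_cases hx : x = 0
    · subst hx; left; simp [singleWeights]
    · right; simp [singleWeights, hx]
  rw [exps_add_eq hdisj, exps_singleWeights 1 ha, exps_singleWeights 0 hb, List.singleton_append,
    List.insertionSort_cons, List.insertionSort_cons, List.insertionSort_nil, List.orderedInsert_nil,
    List.orderedInsert_cons_of_le _ _ hab]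

/-! ## §2 Bent polynomials and their maximal invariant -/

/-- The integer weights `p` on `x = X 0` and `K` on `y = X 1` (i.e. `pK · (1/K, 1/p)`).
[cite: AbramovichTemkinWlodarczyk2024, Rem. 5.2.3 (p. 1576)] -/
def bentWeight (p K : ℕ) : Fin 2 → ℕ := fun i => if i = 0 then p else K

/-- `weight_{(P,Q)}(x^i y^j) = i P + j Q` (plumbing). [cite: AbramovichTemkinWlodarczyk2024, Rem. 2.4.2 (p. 1568)] -/
private theorem weight_bentWeight₂₁ (P Q : ℕ) (d : Fin 2 →₀ ℕ) :
    Finsupp.weight (bentWeight P Q) d = d 0 * P + d 1 * Q := by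
  have h10 : (1 : Fin 2) ≠ 0 := by decide
  conv_lhs => rw [eq_e₂₁ d]
  rw [map_add, Finsupp.weight_single, Finsupp.weight_single, smul_eq_mul, smul_eq_mul]
  simp only [bentWeight, ↓reduceIte, if_neg h10]

/-- The scaled weights of the two-weight centre (plumbing). [folklore] -/
private theorem scaled_bentWeight₂₁ (a b : ℕ) (ha : 0 < a) (hb : 0 < b) :
    ∀ i : Fin 2, ((bentWeight a b i : ℕ) : ℚ) =
      ((a * b : ℕ) : ℚ) * (singleWeights (1 : Fin 2) a + singleWeights (0 : Fin 2) b) i := by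
  have h10 : (1 : Fin 2) ≠ 0 := by decide
  have h01 : (0 : Fin 2) ≠ 1 := by decide
  have haq : (a : ℚ) ≠ 0 := by exact_mod_cast ha.ne'
  have hbq : (b : ℚ) ≠ 0 := by exact_mod_cast hb.ne'
  intro i
  fin_cases i
  · simp only [bentWeight, Fin.zero_eta, ↓reduceIte, Pi.add_apply, singleWeights, if_neg h01, zero_add, Nat.cast_mul]
    rw [mul_inv_cancel_right₀ hbq]
  · simp only [bentWeight, Fin.mk_one, if_neg h10, Pi.add_apply, singleWeights, ↓reduceIte, add_zero, Nat.cast_mul]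
    rw [mul_comm ((a : ℕ) : ℚ), mul_inv_cancel_right₀ haq]

/-- **Bent polynomials.** `G ∈ k[x, y]` is `(p, K, a)`-bent if `G = y^p + x^K − x^a y + R` where every monomial
`x^i y^j` of `R` has `p i + K j ≥ p K + 2`, i.e. `ν_{(p,K)}(R) ≥ pK + 2` for the monomial valuation with weights
`p` on `x`, `K` on `y` (so `y^p` and the vertex `x^K` lie on the face `p i + K j = pK`, `x^a y` has weight `pK + 1`
when `p a + K = p K + 1`, and everything else is at least two above the face). (defined here)
[cite: CossartJannsenSaito2020, Def. 8.2 (1) / Thm. 8.16 (pp. 117–121) (the prepared normal form)]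
[cite: AbramovichTemkinWlodarczyk2024, Rem. 5.2.3 (p. 1576)] -/
def IsBent (p K a : ℕ) (G : MvPolynomial (Fin 2) k) : Prop :=
  ((p * K + 2 : ℕ) : ℕ∞) ≤ monomialOrd (bentWeight p K) (G - (X 1 ^ p + X 0 ^ K - X 0 ^ a * X 1))

/-- The three named monomials, padded (plumbing). [folklore] -/
private theorem core_eq₂₁ (p K a : ℕ) :
    (X 0 ^ 0 * X 1 ^ p + X 0 ^ K * X 1 ^ 0 - X 0 ^ a * X 1 ^ 1 : MvPolynomial (Fin 2) k) =
      X 1 ^ p + X 0 ^ K - X 0 ^ a * X 1 := by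
  rw [pow_zero, one_mul, pow_zero, mul_one, pow_one]

section IsBent

variable {p K a : ℕ} {G : MvPolynomial (Fin 2) k}

/-- The monomials of a bent polynomial: `y^p`, `x^K`, `x^a y`, or weight `≥ pK + 2` (plumbing).
[cite: CossartJannsenSaito2020, Def. 8.2 (1) (pp. 117–118)] -/
private theorem IsBent.mem_support (hb : IsBent p K a G) {d : Fin 2 →₀ ℕ} (hd : d ∈ G.support) :
    d = Finsupp.single 0 0 + Finsupp.single 1 p ∨ d = Finsupp.single 0 K + Finsupp.single 1 0 ∨
      d = Finsupp.single 0 a + Finsupp.single 1 1 ∨ p * K + 2 ≤ d 0 * p + d 1 * K := by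
  classical
  by_cases h : d ∈ (G - (X 1 ^ p + X 0 ^ K - X 0 ^ a * X 1)).support
  · right; right; right
    have := (le_monomialOrd_iff _ _ _).1 hb d h
    rwa [weight_bentWeight₂₁] at this
  · rw [mem_support_iff, not_not, coeff_sub, sub_eq_zero, ← core_eq₂₁, coeff_sub, coeff_add, coeff_X_pow_mul_X_pow₂₁,
      coeff_X_pow_mul_X_pow₂₁, coeff_X_pow_mul_X_pow₂₁] at h
    by_cases h1 : Finsupp.single (0 : Fin 2) 0 + Finsupp.single 1 p = d
    · exact Or.inl h1.symm
    by_cases h2 : Finsupp.single (0 : Fin 2) K + Finsupp.single 1 0 = d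
    · exact Or.inr (Or.inl h2.symm)
    by_cases h3 : Finsupp.single (0 : Fin 2) a + Finsupp.single 1 1 = d
    · exact Or.inr (Or.inr (Or.inl h3.symm))
    rw [if_neg h1, if_neg h2, if_neg h3, add_zero, sub_zero] at h
    exact ((mem_support_iff.1 hd) h).elim

/-- The coefficient of `y^p` in a bent polynomial is `1` (plumbing). [cite: CossartJannsenSaito2020, Def. 8.2 (1)] -/
private theorem IsBent.coeff_e₁ (hb : IsBent p K a G) (hp : 2 ≤ p) :
    G.coeff (Finsupp.single 0 0 + Finsupp.single 1 p) = 1 := by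
  classical
  have hnot : Finsupp.single (0 : Fin 2) 0 + Finsupp.single 1 p ∉ (G - (X 1 ^ p + X 0 ^ K - X 0 ^ a * X 1)).support := by
    intro h
    have := (le_monomialOrd_iff _ _ _).1 hb _ h
    rw [weight_bentWeight₂₁, e_apply_zero₂₁, e_apply_one₂₁] at this
    nlinarith
  rw [mem_support_iff, not_not, coeff_sub, sub_eq_zero, ← core_eq₂₁, coeff_sub, coeff_add, coeff_X_pow_mul_X_pow₂₁,
    coeff_X_pow_mul_X_pow₂₁, coeff_X_pow_mul_X_pow₂₁, if_pos rfl,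
    if_neg (fun h => by have := (e_eq_e_iff₂₁.1 h).2; omega),
    if_neg (fun h => by have := (e_eq_e_iff₂₁.1 h).2; omega)] at hnot
  rw [hnot]; ring

/-- The coefficient of the vertex `x^K` in a bent polynomial is `1` (plumbing). [cite: CossartJannsenSaito2020, Def. 8.2 (1)] -/
private theorem IsBent.coeff_e₂ (hb : IsBent p K a G) (hp : 2 ≤ p) :
    G.coeff (Finsupp.single 0 K + Finsupp.single 1 0) = 1 := by
  classical
  have hnot : Finsupp.single (0 : Fin 2) K + Finsupp.single 1 0 ∉ (G - (X 1 ^ p + X 0 ^ K - X 0 ^ a * X 1)).support := by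
    intro h
    have := (le_monomialOrd_iff _ _ _).1 hb _ h
    rw [weight_bentWeight₂₁, e_apply_zero₂₁, e_apply_one₂₁] at this
    nlinarith
  rw [mem_support_iff, not_not, coeff_sub, sub_eq_zero, ← core_eq₂₁, coeff_sub, coeff_add, coeff_X_pow_mul_X_pow₂₁,
    coeff_X_pow_mul_X_pow₂₁, coeff_X_pow_mul_X_pow₂₁, if_neg (fun h => by have := (e_eq_e_iff₂₁.1 h).2; omega),
    if_pos rfl, if_neg (fun h => by have := (e_eq_e_iff₂₁.1 h).2; omega)] at hnot
  rw [hnot]; ring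

/-- `G = (y^p + x^K − x^a y) + R` (plumbing). [folklore] -/
private theorem IsBent.eq_core_add (G : MvPolynomial (Fin 2) k) (p K a : ℕ) :
    G = (X 0 ^ 0 * X 1 ^ p + X 0 ^ K * X 1 ^ 0 - X 0 ^ a * X 1 ^ 1) + (G - (X 1 ^ p + X 0 ^ K - X 0 ^ a * X 1)) := by
  ring

/-- Every monomial of `R` has total degree `≥ p + 1` (since `K > p`) (plumbing).
[cite: AbramovichTemkinWlodarczyk2024, Rem. 5.2.3 (p. 1576)] -/
private theorem IsBent.succ_le_monomialOrd_one (hb : IsBent p K a G) (hpK : p < K) :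
    ((p + 1 : ℕ) : ℕ∞) ≤ monomialOrd (fun _ => 1) (G - (X 1 ^ p + X 0 ^ K - X 0 ^ a * X 1)) := by
  rw [le_monomialOrd_one_iff]
  intro d hd
  have h := (le_monomialOrd_iff _ _ _).1 hb d hd
  rw [weight_bentWeight₂₁] at h
  rw [degree_fin_two₂₁]
  have h1 : d 0 * p ≤ d 0 * K := Nat.mul_le_mul_left _ hpK.le
  have h2 : p * K < (d 0 + d 1) * K := by rw [add_mul]; omega
  have h3 : p < d 0 + d 1 := Nat.lt_of_mul_lt_mul_right h2
  omega

/-- **A bent polynomial has order `p`.** (derived here) [cite: AbramovichTemkinWlodarczyk2024, §5.1 (p. 1575) (a₁ = ord)] -/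
theorem IsBent.monomialOrd_one (hb : IsBent p K a G) (hp : 2 ≤ p) (hpK : p < K) (hpa : p ≤ a) :
    monomialOrd (fun _ => 1) G = p := by
  classical
  apply le_antisymm
  · have hmem : Finsupp.single (0 : Fin 2) 0 + Finsupp.single 1 p ∈ G.support := by
      rw [mem_support_iff, hb.coeff_e₁ hp]; exact one_ne_zero
    refine (monomialOrd_le_weight (fun _ => 1) hmem).trans (le_of_eq ?_)
    rw [← Finsupp.degree_eq_weight_one, degree_e₂₁, zero_add]
  · rw [IsBent.eq_core_add G p K a]
    refine le_monomialOrd_add₂₁ _ (le_monomialOrd_sub₂₁ _ (le_monomialOrd_add₂₁ _ ?_ ?_) ?_)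
      (le_trans (by exact_mod_cast Nat.le_succ p) (hb.succ_le_monomialOrd_one hpK))
    all_goals rw [monomialOrd_X_pow_mul_X_pow₂₁, mul_one, mul_one]; exact_mod_cast (by omega)

/-- **The initial form of a bent polynomial is `y^p`** (`τ = 1`, directrix `{y = 0}`). (derived here)
[cite: CossartJannsenSaito2020, Def. 8.2 (1) (pp. 117–118)] -/
theorem IsBent.homogeneousComponent_eq (hb : IsBent p K a G) (hpK : p < K) (hpa : p ≤ a) :
    homogeneousComponent p G = X 1 ^ p := by
  classical
  have hc : ∀ i j : ℕ, homogeneousComponent p (X 0 ^ i * X 1 ^ j : MvPolynomial (Fin 2) k) =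
      if p = i + j then X 0 ^ i * X 1 ^ j else 0 := fun i j =>
    homogeneousComponent_of_mem ((isHomogeneous_X_pow (0 : Fin 2) i).mul (isHomogeneous_X_pow 1 j))
  have hR : homogeneousComponent p (G - (X 1 ^ p + X 0 ^ K - X 0 ^ a * X 1)) = 0 :=
    homogeneousComponent_eq_zero_of_lt_monomialOrd _ (Nat.lt_succ_self p) (hb.succ_le_monomialOrd_one hpK)
  rw [IsBent.eq_core_add G p K a, map_add, hR, add_zero, map_sub, map_add, hc, hc, hc, if_pos (zero_add p).symm,
    if_neg (by omega), if_neg (by omega)]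
  simp

/-- **`(p, K) ∈ W(G)` for a bent `G`**: the weights `1/K` on `x`, `1/p` on `y` (no coordinate change) are admissible —
`y^p`, `x^K` have weight `1`, `x^a y` has weight `1 + 1/(pK)`, the rest at least `1 + 2/(pK)`. (derived here)
[cite: AbramovichTemkinWlodarczyk2024, Thm. 5.3.1 (2) (p. 1578), Lemma 5.2.6 (p. 1576)] -/
theorem IsBent.mem_admissibleInvariants (hb : IsBent p K a G) (hp : 2 ≤ p) (hpK : p ≤ K)
    (hrel : p * a + K = p * K + 1) : [(p : ℚ), (K : ℚ)] ∈ admissibleInvariants G := by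
  classical
  have hp0 : 0 < p := by omega
  have hK0 : 0 < K := by omega
  have h10 : (1 : Fin 2) ≠ 0 := by decide
  have hcentre : IsCentreFor G (AlgEquiv.refl : MvPolynomial (Fin 2) k ≃ₐ[k] MvPolynomial (Fin 2) k)
      (singleWeights (1 : Fin 2) p + singleWeights (0 : Fin 2) K) := by
    refine ⟨fun i => ?_, fun x => ?_, ?_⟩
    · change constantCoeff (X i : MvPolynomial (Fin 2) k) = 0
      exact constantCoeff_X k i
    · simp only [Pi.add_apply, singleWeights]
      split_ifs <;> positivity
    · change IsAdmissibleFor _ G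
      rw [isAdmissibleFor_iff_le_monomialOrd _ (bentWeight p K) (N := p * K) (by positivity)
        (scaled_bentWeight₂₁ p K hp0 hK0), IsBent.eq_core_add G p K a]
      refine le_monomialOrd_add₂₁ _ (le_monomialOrd_sub₂₁ _ (le_monomialOrd_add₂₁ _ ?_ ?_) ?_)
        (le_trans (by exact_mod_cast (by omega : p * K ≤ p * K + 2)) hb)
      all_goals
        rw [monomialOrd_X_pow_mul_X_pow₂₁]
        simp only [bentWeight, ↓reduceIte, if_neg h10]
        exact_mod_cast (by nlinarith)
  have h := exps_mem_admissibleInvariants hcentre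
  rwa [exps_singleWeights_add₂₁ hp0 hK0 (by exact_mod_cast hpK)] at h

/-- **`δ(G; x; y) = K/p` for a bent `G`**: among the monomials `x^i y^j` with `j < p`, the vertex `x^K` gives `K/p`,
`x^a y` gives `a/(p − 1) ≥ K/p` (as `p a = (p−1)K + 1`), and a monomial with `p i + K j ≥ pK + 2` gives
`i/(p − j) ≥ K/p`. (derived here) [cite: CossartJannsenSaito2020, Def. 8.1 (3) / Def. 8.2 (1) (pp. 117–118)] -/
theorem IsBent.hironakaDelta_eq (hb : IsBent p K a G) (hp : 2 ≤ p) (hrel : p * a + K = p * K + 1) :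
    hironakaDelta ({1} : Finset (Fin 2)) p G = ((((K : ℕ) : ℚ) / (p : ℚ) : ℚ) : WithTop ℚ) := by
  classical
  have hp0 : 0 < p := by omega
  have hp1 : 1 < p := by omega
  have hp0q : (0 : ℚ) < p := by exact_mod_cast hp0
  have hp1q : (1 : ℚ) < p := by exact_mod_cast hp1
  have hpsub : (((p - 1 : ℕ) : ℚ)) = (p : ℚ) - 1 := by rw [Nat.cast_sub hp1.le, Nat.cast_one]
  have hrelq : ((p : ℚ) * a + K) = p * K + 1 := by exact_mod_cast hrel
  apply le_antisymm
  · unfold hironakaDelta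
    have hmem : Finsupp.single (0 : Fin 2) K + Finsupp.single 1 0 ∈ G.support := by
      rw [mem_support_iff, hb.coeff_e₂ hp]; exact one_ne_zero
    refine (Finset.inf_le (Finset.mem_filter.2 ⟨hmem, ?_⟩)).trans (le_of_eq ?_)
    · rw [blockDeg_singleton, e_apply_one₂₁]; exact hp0
    · rw [coDeg_singleton, blockDeg_singleton, degree_e₂₁, e_apply_one₂₁, Nat.add_zero, Nat.sub_zero, Nat.sub_zero]
  · rw [le_hironakaDelta_iff]
    intro d hd hb1
    rw [blockDeg_singleton] at hb1
    rw [coDeg_singleton, blockDeg_singleton, degree_fin_two₂₁, Nat.add_sub_cancel]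
    rcases hb.mem_support hd with rfl | rfl | rfl | h
    · exfalso
      rw [e_apply_one₂₁] at hb1
      exact lt_irrefl _ hb1
    · rw [e_apply_zero₂₁, e_apply_one₂₁, Nat.sub_zero]
    · rw [e_apply_zero₂₁, e_apply_one₂₁, hpsub, div_le_div_iff₀ hp0q (by linarith)]
      nlinarith
    · have hlt : ((d 1 : ℕ) : ℚ) < p := by exact_mod_cast hb1
      have hq : ((p * K + 2 : ℕ) : ℚ) ≤ ((d 0 * p + d 1 * K : ℕ) : ℚ) := by exact_mod_cast h
      push_cast at hq
      rw [Nat.cast_sub hb1.le, div_le_div_iff₀ hp0q (by linarith)]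
      nlinarith

/-- **A bent polynomial has `max W(G) = (p, K)`** (`2 ≤ p < K`, `p a + K = p K + 1`, `p ∤ K`, any field): `(p, K)` is
the invariant of the weights `(1/K, 1/p)`, and no invariant of a centre admissible for `G` — after any polynomial
coordinate change — exceeds it, by the two-variable vertex bound (`ord = p`, `in_p = y^p`, `δ = K/p ∉ ℕ` so `G` is
`δ`-prepared). (derived here) [cite: CossartJannsenSaito2020, Thm. 8.16 (p. 121)]
[cite: AbramovichTemkinWlodarczyk2024, Thm. 5.1.1 / §5.3 (pp. 1575–1578)] -/
theorem IsBent.isMaxInv (hb : IsBent p K a G) (hp : 2 ≤ p) (hpK : p < K) (hrel : p * a + K = p * K + 1)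
    (hdiv : ¬ p ∣ K) : IsMaxInv (admissibleInvariants G) [(p : ℚ), (K : ℚ)] := by
  have hpa : p ≤ a := by
    obtain ⟨q, rfl⟩ : ∃ q, p = q + 2 := ⟨p - 2, by omega⟩
    nlinarith
  refine ⟨hb.mem_admissibleInvariants hp hpK.le hrel, fun c hc => ?_⟩
  exact not_lt_of_mem_admissibleInvariants_of_vertex₂ (by omega) (hb.monomialOrd_one hp hpK hpa)
    (hb.homogeneousComponent_eq hpK hpa) (hb.hironakaDelta_eq hp hrel)
    (isDeltaPrepared_of_hironakaDelta_eq_div (by omega) (hb.hironakaDelta_eq hp hrel) hdiv) hc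

end IsBent

/-! ## §3 The substitution `x ↦ x^p, y ↦ y − x^K` maps bent to bent -/

/-- **The substitution `T_K : x ↦ x^p, y ↦ y − x^K`** (an algebra endomorphism of `k[x, y]`, not a coordinate change;
it relates the bent forms of consecutive rungs: `G_{e+1}(x, y) = G_e(x^p, y − x^{K_e})`).
[cite: CossartJannsenSaito2020, Thm. 8.16 (p. 121) (vertex preparation y ↦ y + λ u^A)] [cite: Hauser2010, §D (p. 12)] -/
def bendSubst (p K : ℕ) : MvPolynomial (Fin 2) k →ₐ[k] MvPolynomial (Fin 2) k :=
  aeval ![X 0 ^ p, X 1 - X 0 ^ K]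

/-- `T_K(x) = x^p`. (derived here) [cite: CossartJannsenSaito2020, Thm. 8.16 (p. 121)] -/
@[simp] theorem bendSubst_X_zero (p K : ℕ) : bendSubst p K (X 0 : MvPolynomial (Fin 2) k) = X 0 ^ p := by
  simp [bendSubst]

/-- `T_K(y) = y − x^K`. (derived here) [cite: CossartJannsenSaito2020, Thm. 8.16 (p. 121)] -/
@[simp] theorem bendSubst_X_one (p K : ℕ) : bendSubst p K (X 1 : MvPolynomial (Fin 2) k) = X 1 - X 0 ^ K := by
  simp [bendSubst]

/-- **Domination: `ν_{(p, K')}(T_K R) ≥ ν_{(p², pK)}(R)`** for any `K'` with `pK ≤ K'` — `T_K(x) = x^p` has weight `p·p`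
and `T_K(y) = y − x^K` has weight `≥ pK` for the weights `(p, K')`. (derived here)
[cite: AbramovichTemkinWlodarczyk2024, Def. 2.4.1 (2) / Rem. 5.2.3 (pp. 1568, 1576) (domination)] -/
theorem monomialOrd_le_monomialOrd_bendSubst (p K K' : ℕ) (hK' : p * K ≤ K') (R : MvPolynomial (Fin 2) k) :
    monomialOrd (bentWeight (p * p) (p * K)) R ≤ monomialOrd (bentWeight p K') (bendSubst p K R) := by
  have h10 : (1 : Fin 2) ≠ 0 := by decide
  have hX0 : ((bentWeight (p * p) (p * K) 0 : ℕ) : ℕ∞) ≤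
      ((monomialAddVal (bentWeight p K')).comap (bendSubst (k := k) p K).toRingHom) (X 0) := by
    change ((bentWeight (p * p) (p * K) 0 : ℕ) : ℕ∞) ≤ monomialOrd (bentWeight p K') (bendSubst p K (X 0))
    rw [bendSubst_X_zero, monomialOrd_X_pow₂₁]
    simp only [bentWeight, ↓reduceIte, le_refl]
  have hX1 : ((bentWeight (p * p) (p * K) 1 : ℕ) : ℕ∞) ≤
      ((monomialAddVal (bentWeight p K')).comap (bendSubst (k := k) p K).toRingHom) (X 1) := by
    change ((bentWeight (p * p) (p * K) 1 : ℕ) : ℕ∞) ≤ monomialOrd (bentWeight p K') (bendSubst p K (X 1))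
    rw [bendSubst_X_one]
    refine le_monomialOrd_sub₂₁ _ ?_ ?_
    · rw [monomialOrd_X]
      simp only [bentWeight, if_neg h10]
      exact_mod_cast hK'
    · rw [monomialOrd_X_pow₂₁]
      simp only [bentWeight, if_neg h10, ↓reduceIte]
      exact_mod_cast (le_of_eq (mul_comm p K))
  have hX : ∀ i, ((bentWeight (p * p) (p * K) i : ℕ) : ℕ∞) ≤
      ((monomialAddVal (bentWeight p K')).comap (bendSubst (k := k) p K).toRingHom) (X i) :=
    Fin.forall_fin_two.2 ⟨hX0, hX1⟩
  exact monomialOrd_le_addValuation _ _ hX R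

section Step

variable {p K a : ℕ} {G : MvPolynomial (Fin 2) k}

/-- **The bending step.** In characteristic `p`, if `G` is `(p, K, a)`-bent with `p a + K = p K + 1`, then
`T_K G = G(x^p, y − x^K)` is `(p, pK + 1, pa)`-bent: `T_K(y^p + x^K − x^a y) = (y − x^K)^p + x^{pK} − x^{pa}(y − x^K)
= y^p + x^{pK+1} − x^{pa} y` (Frobenius: the vertex `x^{pK}` dissolves, the new vertex is `x^{pa+K} = x^{pK+1}`), and
`ν_{(p, pK+1)}(T_K R) ≥ p · ν_{(p,K)}(R) ≥ p(pK + 2) ≥ p(pK + 1) + 2`. (derived here)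
[cite: CossartJannsenSaito2020, Def. 8.8 / Thm. 8.16 (pp. 119–121) (vertex preparation)]
[cite: Hauser2010, §D (p. 12) (kangaroo phenomenon)] [cite: AbramovichTemkinWlodarczyk2024, Rem. 5.2.3 (p. 1576)] -/
theorem IsBent.step [hp : Fact p.Prime] [CharP k p] (hb : IsBent p K a G) (hrel : p * a + K = p * K + 1) :
    IsBent p (p * K + 1) (p * a) (bendSubst p K G) := by
  classical
  haveI : ExpChar (MvPolynomial (Fin 2) k) p := ExpChar.prime hp.out
  have hp2 : 2 ≤ p := hp.out.two_le
  have h10 : (1 : Fin 2) ≠ 0 := by decide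
  have hX : (X 0 : MvPolynomial (Fin 2) k) ^ (p * a) * X 0 ^ K = X 0 ^ (p * K + 1) := by rw [← pow_add, hrel]
  have hkey : bendSubst p K G - (X 1 ^ p + X 0 ^ (p * K + 1) - X 0 ^ (p * a) * X 1) =
      bendSubst p K (G - (X 1 ^ p + X 0 ^ K - X 0 ^ a * X 1)) := by
    rw [map_sub (bendSubst p K) G, map_sub, map_add, map_pow, map_pow, map_mul, map_pow, bendSubst_X_zero,
      bendSubst_X_one, sub_pow_expChar, ← pow_mul, ← pow_mul, ← pow_mul, mul_comm K p, ← hX]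
    ring
  unfold IsBent
  rw [hkey]
  have h2 : ((p * (p * K + 2) : ℕ) : ℕ∞) ≤
      monomialOrd (bentWeight (p * p) (p * K)) (G - (X 1 ^ p + X 0 ^ K - X 0 ^ a * X 1)) := by
    rw [le_monomialOrd_iff]
    intro d hd
    have h := (le_monomialOrd_iff _ _ _).1 hb d hd
    rw [weight_bentWeight₂₁] at h ⊢
    nlinarith
  calc ((p * (p * K + 1) + 2 : ℕ) : ℕ∞) ≤ ((p * (p * K + 2) : ℕ) : ℕ∞) := by exact_mod_cast (by nlinarith)
    _ ≤ _ := h2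
    _ ≤ _ := monomialOrd_le_monomialOrd_bendSubst p K (p * K + 1) (Nat.le_succ _) _

end Step

/-! ## §4 The ladder `K_e = 1 + p + ⋯ + p^e`, the shifts `γ_e` and the bent forms `G_e` -/

/-- **`K_e`**: `K_0 = 1`, `K_{e+1} = p K_e + 1`, i.e. `K_e = 1 + p + ⋯ + p^e = (p^{e+1} − 1)/(p − 1)`.
[cite: Hauser2010, §D (p. 12)] [cite: HauserPerlega2019PRIMS, §7 (p. 798)] -/
def bendK (p : ℕ) : ℕ → ℕ
  | 0 => 1
  | e + 1 => p * bendK p e + 1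

/-- `K_0 = 1`. (derived here) [cite: Hauser2010, §D (p. 12)] -/
@[simp] theorem bendK_zero (p : ℕ) : bendK p 0 = 1 := rfl

/-- `K_{e+1} = p K_e + 1`. (derived here) [cite: Hauser2010, §D (p. 12)] -/
@[simp] theorem bendK_succ (p e : ℕ) : bendK p (e + 1) = p * bendK p e + 1 := rfl

/-- **`K_e = Σ_{i ≤ e} p^i`.** (derived here) [cite: Hauser2010, §D (p. 12)] -/
theorem bendK_eq_sum (p e : ℕ) : bendK p e = ∑ i ∈ Finset.range (e + 1), p ^ i := by
  induction e with
  | zero => simp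
  | succ e ih =>
    rw [bendK_succ, ih, Finset.sum_range_succ' (fun i => p ^ i) (e + 1), Finset.mul_sum, pow_zero]
    simp [pow_succ']

/-- **`(p − 1) K_e + 1 = p^{e+1}`**, in the subtraction-free form `p · p^e + K_e = p K_e + 1`. (derived here)
[cite: Hauser2010, §D (p. 12)] -/
theorem bend_rel (p e : ℕ) : p * p ^ e + bendK p e = p * bendK p e + 1 := by
  induction e with
  | zero => simp
  | succ e ih =>
    rw [bendK_succ, pow_succ]
    have h2 : p * (p * p ^ e + bendK p e) = p * (p * bendK p e + 1) := by rw [ih]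
    nlinarith [h2]

/-- `K_e ≥ 1`. (derived here) [cite: Hauser2010, §D (p. 12)] -/
theorem bendK_pos (p e : ℕ) : 0 < bendK p e := by
  cases e with
  | zero => exact Nat.one_pos
  | succ e => rw [bendK_succ]; exact Nat.succ_pos _

/-- `p < K_e` for `e ≥ 1`. (derived here) [cite: Hauser2010, §D (p. 12)] -/
theorem lt_bendK (p : ℕ) {e : ℕ} (he : 1 ≤ e) : p < bendK p e := by
  obtain ⟨e, rfl⟩ : ∃ e', e = e' + 1 := ⟨e - 1, by omega⟩
  rw [bendK_succ]
  have := Nat.mul_le_mul_left p (bendK_pos p e)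
  omega

/-- `p ∤ K_e` for `e ≥ 1` (`K_e ≡ 1 mod p`, `p ≥ 2`). (derived here) [cite: Hauser2010, §D (p. 12)] -/
theorem not_dvd_bendK {p e : ℕ} (hp : 2 ≤ p) (he : 1 ≤ e) : ¬ p ∣ bendK p e := by
  obtain ⟨e, rfl⟩ : ∃ e', e = e' + 1 := ⟨e - 1, by omega⟩
  rw [bendK_succ]
  intro h
  have h1 : p ∣ 1 := (Nat.dvd_add_right ⟨bendK p e, rfl⟩).1 h
  have := Nat.le_of_dvd Nat.one_pos h1
  omega

/-- **The shift `γ_e ∈ k[x]`**: `γ_0 = 0`, `γ_{e+1} = T_{K_e} γ_e + x^{K_e}`; so `γ_1 = x`, `γ_2 = x^p + x^{p+1}`,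
`γ_3 = x^{p²} + x^{p²+p} + x^{p²+p+1}`, …, `γ_e = Σ_{m<e} x^{p^{e−1−m} K_m}`. (defined here)
[cite: CossartJannsenSaito2020, Def. 8.8 / Thm. 8.16 (pp. 119–121)] [cite: Hauser2010, §D (p. 12)] -/
def bendShift (k : Type*) [Field k] (p : ℕ) : ℕ → MvPolynomial (Fin 2) k
  | 0 => 0
  | e + 1 => bendSubst p (bendK p e) (bendShift k p e) + X 0 ^ bendK p e

/-- `γ_0 = 0`. (derived here) [cite: Hauser2010, §D (p. 12)] -/
@[simp] theorem bendShift_zero (p : ℕ) : bendShift k p 0 = 0 := rfl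

/-- `γ_{e+1} = T_{K_e} γ_e + x^{K_e}`. (derived here) [cite: Hauser2010, §D (p. 12)] -/
theorem bendShift_succ (p e : ℕ) :
    bendShift k p (e + 1) = bendSubst p (bendK p e) (bendShift k p e) + X 0 ^ bendK p e := rfl

/-- `γ_1 = x`. (derived here) [cite: Hauser2010, §D (p. 12)] -/
theorem bendShift_one (p : ℕ) : bendShift k p 1 = X 0 := by
  rw [bendShift_succ, bendShift_zero, map_zero, zero_add, bendK_zero, pow_one]

/-- `γ_2 = x^p + x^{p+1}` (the shift of `WeightedCentreBendingWitness`). (derived here) [cite: Hauser2010, §D (p. 12)] -/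
theorem bendShift_two (p : ℕ) : bendShift k p 2 = X 0 ^ p + X 0 ^ (p + 1) := by
  rw [bendShift_succ, bendShift_one, bendSubst_X_zero, bendK_succ, bendK_zero, mul_one]

/-- `γ_e` does not involve `y`. (derived here) [cite: CossartJannsenSaito2020, Thm. 8.16 (p. 121) (y ↦ y + q(u))] -/
theorem one_notMem_vars_bendShift (p e : ℕ) : (1 : Fin 2) ∉ (bendShift k p e).vars := by
  classical
  have h10 : (1 : Fin 2) ≠ 0 := by decide
  induction e with
  | zero => simp
  | succ e ih =>
    intro h
    rw [bendShift_succ] at h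
    rcases Finset.mem_union.1 (vars_add_subset _ _ h) with h | h
    · rw [bendSubst, aeval_eq_bind₁] at h
      obtain ⟨i, hi, h1⟩ := Finset.mem_biUnion.1 (vars_bind₁ _ _ h)
      fin_cases i
      · simp only [Fin.zero_eta, Matrix.cons_val_zero] at h1
        exact h10 (by simpa [vars_X] using vars_pow _ _ h1)
      · exact ih hi
    · exact h10 (by simpa [vars_X] using vars_pow _ _ h)

/-- `γ_e` vanishes at the origin: `ord γ_e ≥ 1`. (derived here) [cite: AbramovichTemkinWlodarczyk2024, Rem. 5.2.3 (p. 1576)] -/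
theorem one_le_monomialOrd_one_bendShift {p : ℕ} (hp : p ≠ 0) (e : ℕ) :
    (1 : ℕ∞) ≤ monomialOrd (fun _ => 1) (bendShift k p e) := by
  induction e with
  | zero => rw [bendShift_zero, monomialOrd_zero]; exact le_top
  | succ e ih =>
    rw [bendShift_succ]
    refine le_monomialOrd_add₂₁ _ ?_ ?_
    · refine ih.trans (monomialOrd_le_monomialOrd_map (fun _ => 1) (bendSubst (k := k) p (bendK p e)).toRingHom
        (fun i => ?_) _)
      change ((1 : ℕ) : ℕ∞) ≤ monomialOrd (fun _ => 1) (bendSubst p (bendK p e) (X i))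
      fin_cases i
      · rw [Fin.zero_eta, bendSubst_X_zero, monomialOrd_X_pow₂₁, mul_one]
        exact_mod_cast Nat.one_le_iff_ne_zero.2 hp
      · rw [Fin.mk_one, bendSubst_X_one]
        refine le_monomialOrd_sub₂₁ _ ?_ ?_
        · rw [monomialOrd_X]
        · rw [monomialOrd_X_pow₂₁, mul_one]
          exact_mod_cast bendK_pos p e
    · rw [monomialOrd_X_pow₂₁, mul_one]
      exact_mod_cast bendK_pos p e

/-- `γ_e(0) = 0`. (derived here) [cite: AbramovichTemkinWlodarczyk2024, Rem. 5.2.3 (p. 1576)] -/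
theorem constantCoeff_bendShift {p : ℕ} (hp : p ≠ 0) (e : ℕ) : constantCoeff (bendShift k p e) = 0 := by
  by_contra h
  have h0 := monomialOrd_eq_zero_of_constantCoeff_ne_zero (fun _ => (1 : ℕ)) h
  have h1 := one_le_monomialOrd_one_bendShift (k := k) hp e
  rw [h0] at h1
  exact absurd h1 (by decide)

/-- **The bent form `G_e = F_e(x, y − γ_e)`** of `F_e = x^{p^e} + y^p + y^{p+1}`. (defined here)
[cite: CossartJannsenSaito2020, Def. 8.2 / Thm. 8.16 (p. 121) (the prepared form after y ↦ y + q(u))]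
[cite: Hauser2010, §D (p. 12)] -/
def bendForm (k : Type*) [Field k] (p e : ℕ) : MvPolynomial (Fin 2) k :=
  (addPolyShear 1 (bendShift k p e)).symm (X 0 ^ p ^ e + (X 1 ^ p + X 1 ^ (p + 1)))

/-- `G_e = x^{p^e} + (y − γ_e)^p + (y − γ_e)^{p+1}`. (derived here) [cite: CossartJannsenSaito2020, Def. 8.2 (p. 118)] -/
theorem bendForm_eq (p e : ℕ) :
    bendForm k p e = X 0 ^ p ^ e + ((X 1 - bendShift k p e) ^ p + (X 1 - bendShift k p e) ^ (p + 1)) := by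
  classical
  have h01 : (0 : Fin 2) ≠ 1 := by decide
  have hsymm1 : (addPolyShear 1 (bendShift k p e)).symm (X 1 : MvPolynomial (Fin 2) k) = X 1 - bendShift k p e := by
    rw [addPolyShear_symm_X_self₂₁, killVar_eq_self_of_notMem (one_notMem_vars_bendShift (k := k) p e)]
  have hsymm0 : (addPolyShear 1 (bendShift k p e)).symm (X 0 : MvPolynomial (Fin 2) k) = X 0 :=
    addPolyShear_symm_X_of_ne₂₁ 1 _ h01
  rw [bendForm, map_add, map_add, map_pow, map_pow, map_pow, hsymm0, hsymm1]

/-- **The recursion `G_{e+1} = T_{K_e} G_e`**: `F_{e+1}(x, z) = F_e(x^p, z)` and `y − γ_{e+1} = (y − x^{K_e}) − T_{K_e} γ_e`.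
(derived here) [cite: CossartJannsenSaito2020, Thm. 8.16 (p. 121) (vertex preparation, one vertex at a time)]
[cite: Hauser2010, §D (p. 12)] -/
theorem bendForm_succ (p e : ℕ) : bendForm k p (e + 1) = bendSubst p (bendK p e) (bendForm k p e) := by
  rw [bendForm_eq, bendForm_eq, map_add, map_add, map_pow, map_pow, map_pow, map_sub, bendSubst_X_zero,
    bendSubst_X_one, bendShift_succ, pow_succ' p e, pow_mul]
  have hsub : (X 1 - (bendSubst p (bendK p e) (bendShift k p e) + X 0 ^ bendK p e) : MvPolynomial (Fin 2) k) =
      X 1 - X 0 ^ bendK p e - bendSubst p (bendK p e) (bendShift k p e) := by ring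
  rw [hsub]

/-- `W(G_e) = W(x^{p^e} + y^p + y^{p+1})` (origin-fixing coordinate change). (derived here)
[cite: AbramovichTemkinWlodarczyk2024, Thm. 1.1.1 (3) (p. 1562) (functoriality)] -/
theorem admissibleInvariants_bendForm {p : ℕ} (hp : p ≠ 0) (e : ℕ) :
    admissibleInvariants (bendForm k p e) =
      admissibleInvariants (X 0 ^ p ^ e + (X 1 ^ p + X 1 ^ (p + 1)) : MvPolynomial (Fin 2) k) := by
  rw [bendForm]
  exact admissibleInvariants_map_eq _ (constantCoeff_symm_X_eq_zero_of_forall _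
    (constantCoeff_addPolyShear_X 1 (constantCoeff_bendShift (k := k) hp e))) _

section Ladder

variable (p : ℕ) [hp : Fact p.Prime] [CharP k p]

/-- **The first rung is bent**: `G_1 = x^p + (y − x)^p + (y − x)^{p+1} = y^p + x^{p+1} − x^p y + (y^{p+1} − x y^p)`
(Frobenius), and `y^{p+1}`, `x y^p` have weights `(p+1)², p² + 2p ≥ p(p+1) + 2`. (derived here)
[cite: CossartJannsenSaito2020, Def. 8.2 (1) (p. 118)] [cite: Hauser2010, §C (p. 9)] -/
theorem isBent_bendForm_one : IsBent p (bendK p 1) (p ^ 1) (bendForm k p 1) := by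
  classical
  haveI : ExpChar (MvPolynomial (Fin 2) k) p := ExpChar.prime hp.out
  have hp2 : 2 ≤ p := hp.out.two_le
  have h10 : (1 : Fin 2) ≠ 0 := by decide
  have hR : bendForm k p 1 - (X 1 ^ p + X 0 ^ bendK p 1 - X 0 ^ p ^ 1 * X 1) =
      X 0 ^ 0 * X 1 ^ (p + 1) - X 0 ^ 1 * X 1 ^ p := by
    rw [bendForm_eq, bendShift_one, bendK_succ, bendK_zero, mul_one, pow_one, pow_one, pow_succ (X 1 - X 0) p,
      sub_pow_expChar]
    ring
  unfold IsBent
  rw [hR]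
  refine le_monomialOrd_sub₂₁ _ ?_ ?_
  all_goals
    rw [monomialOrd_X_pow_mul_X_pow₂₁, bendK_succ, bendK_zero]
    simp only [bentWeight, ↓reduceIte, if_neg h10]
    exact_mod_cast (by nlinarith)

/-- **Every rung is bent: `G_e` is `(p, K_e, p^e)`-bent for `e ≥ 1`** (induction via `bendForm_succ` and the bending
step). (derived here) [cite: CossartJannsenSaito2020, Thm. 8.16 (p. 121)] [cite: Hauser2010, §D (p. 12)] -/
theorem isBent_bendForm {e : ℕ} (he : 1 ≤ e) : IsBent p (bendK p e) (p ^ e) (bendForm k p e) := by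
  induction e, he using Nat.le_induction with
  | base => exact isBent_bendForm_one (k := k) p
  | succ e he ih =>
    rw [bendForm_succ, bendK_succ, pow_succ']
    exact ih.step (bend_rel p e)

/-- **`max W(G_e) = (p, K_e)`** for `e ≥ 1`. (derived here) [cite: CossartJannsenSaito2020, Thm. 8.16 (p. 121)]
[cite: AbramovichTemkinWlodarczyk2024, Thm. 5.1.1 / §5.3 (pp. 1575–1578)] -/
theorem isMaxInv_bendForm {e : ℕ} (he : 1 ≤ e) :
    IsMaxInv (admissibleInvariants (bendForm k p e)) [(p : ℚ), ((bendK p e : ℕ) : ℚ)] :=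
  (isBent_bendForm (k := k) p he).isMaxInv hp.out.two_le (lt_bendK p he) (bend_rel p e)
    (not_dvd_bendK hp.out.two_le he)

/-- **The bending ladder: `max W(x^{p^e} + y^p + y^{p+1}) = (p, K_e)`, `K_e = 1 + p + ⋯ + p^e = (p^{e+1} − 1)/(p − 1)`,
for every prime `p` (the characteristic) and every `e ≥ 1`**, over all admissible centres after all polynomial
coordinate changes.  The split law offers only `(p, p^e)`; the maximal centre bends `e` times. (derived here)
[cite: CossartJannsenSaito2020, Thm. 8.16 (p. 121)] [cite: Hauser2010, §C (p. 9) and §D (p. 12)]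
[cite: HauserPerlega2019PRIMS, §7 (p. 798)] [cite: AbramovichTemkinWlodarczyk2024, Thm. 5.3.1 (2)–(3) (p. 1578)] -/
theorem isMaxInv_bending_pow {e : ℕ} (he : 1 ≤ e) :
    IsMaxInv (admissibleInvariants (X 0 ^ p ^ e + (X 1 ^ p + X 1 ^ (p + 1)) : MvPolynomial (Fin 2) k))
      [(p : ℚ), ((bendK p e : ℕ) : ℚ)] := by
  rw [← admissibleInvariants_bendForm hp.out.ne_zero]
  exact isMaxInv_bendForm (k := k) p he

/-- The ladder in closed form: **`max W(x^{p^e} + y^p + y^{p+1}) = (p, Σ_{i ≤ e} p^i)`**, `e ≥ 1`. (derived here)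
[cite: CossartJannsenSaito2020, Thm. 8.16 (p. 121)] [cite: Hauser2010, §D (p. 12)] -/
theorem isMaxInv_bending_pow_sum {e : ℕ} (he : 1 ≤ e) :
    IsMaxInv (admissibleInvariants (X 0 ^ p ^ e + (X 1 ^ p + X 1 ^ (p + 1)) : MvPolynomial (Fin 2) k))
      [(p : ℚ), ((∑ i ∈ Finset.range (e + 1), p ^ i : ℕ) : ℚ)] := by
  rw [← bendK_eq_sum]
  exact isMaxInv_bending_pow (k := k) p he

/-- The fourth rung: **`max W(x^{p⁴} + y^p + y^{p+1}) = (p, p⁴ + p³ + p² + p + 1)`** (the rungs `e = 2, 3` are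
`isMaxInv_bending` of `WeightedCentreBendingWitness` and `isMaxInv_bending₃` of `WeightedCentreBendingCube`). (derived here)
[cite: Hauser2010, §D (p. 12)] [cite: CossartJannsenSaito2020, Thm. 8.16 (p. 121)] -/
theorem isMaxInv_bending_pow_four :
    IsMaxInv (admissibleInvariants (X 0 ^ p ^ 4 + (X 1 ^ p + X 1 ^ (p + 1)) : MvPolynomial (Fin 2) k))
      [(p : ℚ), ((p ^ 4 + p ^ 3 + p ^ 2 + p + 1 : ℕ) : ℚ)] := by
  have h := isMaxInv_bending_pow (k := k) p (e := 4) (by norm_num)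
  have hK : bendK p 4 = p ^ 4 + p ^ 3 + p ^ 2 + p + 1 := by simp [bendK]; ring
  rwa [hK] at h

end Ladder

/-! ## §5 Characteristic `2`: `max W(x¹⁶ + y² + y³) = (2, 31)` and `max W(x³² + y² + y³) = (2, 63)` -/

/-- **`max W(x¹⁶ + y² + y³) = (2, 31)` in characteristic `2`** (after `(2,3)`, `(2,7)`, `(2,15)` for `x², x⁴, x⁸`).
(derived here) [cite: Hauser2010, §C (p. 9) and §D (p. 12)] [cite: CossartJannsenSaito2020, Thm. 8.16 (p. 121)] -/
theorem isMaxInv_bending_two_pow_four [CharP k 2] :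
    IsMaxInv (admissibleInvariants (X 0 ^ 16 + (X 1 ^ 2 + X 1 ^ 3) : MvPolynomial (Fin 2) k)) [(2 : ℚ), 31] := by
  haveI : Fact (Nat.Prime 2) := ⟨Nat.prime_two⟩
  have h := isMaxInv_bending_pow (k := k) 2 (e := 4) (by norm_num)
  norm_num [bendK] at h
  exact h

/-- **`max W(x³² + y² + y³) = (2, 63)` in characteristic `2`.** (derived here) [cite: Hauser2010, §D (p. 12)]
[cite: CossartJannsenSaito2020, Thm. 8.16 (p. 121)] -/
theorem isMaxInv_bending_two_pow_five [CharP k 2] :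
    IsMaxInv (admissibleInvariants (X 0 ^ 32 + (X 1 ^ 2 + X 1 ^ 3) : MvPolynomial (Fin 2) k)) [(2 : ℚ), 63] := by
  haveI : Fact (Nat.Prime 2) := ⟨Nat.prime_two⟩
  have h := isMaxInv_bending_pow (k := k) 2 (e := 5) (by norm_num)
  norm_num [bendK] at h
  exact h

/-- **`max W(x²⁷ + y³ + y⁴) = (3, 40)` in characteristic `3`** (`K_3 = 1 + 3 + 9 + 27`). (derived here)
[cite: Hauser2010, §D (p. 12)] [cite: CossartJannsenSaito2020, Thm. 8.16 (p. 121)] -/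
theorem isMaxInv_bending_three_pow_three [CharP k 3] :
    IsMaxInv (admissibleInvariants (X 0 ^ 27 + (X 1 ^ 3 + X 1 ^ 4) : MvPolynomial (Fin 2) k)) [(3 : ℚ), 40] := by
  haveI : Fact (Nat.Prime 3) := ⟨Nat.prime_three⟩
  have h := isMaxInv_bending_pow (k := k) 3 (e := 3) (by norm_num)
  norm_num [bendK] at h
  exact h

/-- **`max W(x²⁵ + y⁵ + y⁶) = (5, 31)` in characteristic `5`** (`K_2 = 1 + 5 + 25`). (derived here)
[cite: Hauser2010, §D (p. 12)] [cite: CossartJannsenSaito2020, Thm. 8.16 (p. 121)] -/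
theorem isMaxInv_bending_five_pow_two [CharP k 5] :
    IsMaxInv (admissibleInvariants (X 0 ^ 25 + (X 1 ^ 5 + X 1 ^ 6) : MvPolynomial (Fin 2) k)) [(5 : ℚ), 31] := by
  haveI : Fact (Nat.Prime 5) := ⟨Nat.prime_five⟩
  have h := isMaxInv_bending_pow (k := k) 5 (e := 2) (by norm_num)
  norm_num [bendK] at h
  exact h

end WeightedBlowup

end Literature.AlgebraicGeometry.Resolution
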